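import Literature.Analysis.FluidPDE.SereginSverakScaledEnergy
import Literature.Analysis.FluidPDE.LocalEnergyMollifiedBounds
import Literature.Analysis.FluidPDE.WeakGradientExtraction
import Literature.Analysis.FluidPDE.SuitableWeakExhaustion
import Mathlib.Geometry.Manifold.PartitionOfUnity
import HarnessLib

/-!
# Seregin–Šverák 2009, proof of Lemma 3.5, (as6): the gradient energy bound, discharged

Sibling file of `SereginSverakScaledEnergy.lean`, which vendors the first input (as6) of the
printed proof of Lemma 3.5 of G. Seregin, V. Šverák, *On Type I singularities of the local
axi-symmetric solutions of the Navier–Stokes equations*, Comm. PDE 34 (2009) 171–201 =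
arXiv:0804.1803 (p. 9: "By Lemma 3.3 and by Remark 3.4, we have … (as6)
`A(0, 3/4; v) + E(0, 3/4; v) ≤ C₂ < +∞`") as the named fact
`SereginSverak2009.GradientEnergyBound`: under the assumptions of Thm. 3.1 the velocity has a
weak spatial gradient `∇v = G` on `Q = 𝒞 × ]-1, 0[` and `A(0, 3/4; v) + E(0, 3/4; ∇v) < ∞`.
This file PROVES it (`SereginSverak2009.GradientEnergyBound_holds`).

## The printed argument and its proof here

(as6) is quoted from Remark 3.4 (p. 9): under the standing assumptions (`v ∈ L³(Q)`,
`q ∈ L^{3/2}(Q)`, Navier–Stokes in `𝒟'(Q)`) and (r2) (`v ∈ L_∞(𝒞 × ]-1, -a²[)` for all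
`0 < a < 1`, which follows from the Type I bound (r3), `isBoundedAwayFromZero_of_isTypeIOnCyl`),
"the pair `v` and `q` forms a suitable weak solution … in `Q`" in the sense of Def. 2.2, whose
classes `v ∈ L_{2,∞}(Q) ∩ W^{1,0}_2(Q)` are GLOBAL in `Q`; p. 6 explains: "It is certainly true
in `B × ]-1, -a²[` but condition (b8) [the standing assumptions] allows us to extend this
property to the whole cylinder `Q`." Finiteness of `A(0, 3/4) + E(0, 3/4)` is exactly this
extension up to the final time `t = 0`. Axial symmetry is not used.

Proof (energy method by space–time mollification, all analytic inputs proved in the tree):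

* `FluidPDE/LocalEnergyMollifiedBounds` (`exists_eventually_mollified_energy_le`): for the
  mollifications `Vₙ = kₙ ⋆ 𝟙_Q v` and a cut-off `φ ≥ 0`, uniformly in the time `t < 0`,
  `∫ φ(t)|Vₙ(t)|² + 2 ∫∫_{s<t} φ|DVₙ|² ≤ M` for large `n`, as long as `v` is bounded below
  `t` (which (r2) provides) — the local energy identity of the mollified system with the cubic
  term treated by absorption and by the transport identity;
* `FluidPDE/WeakGradientExtraction` (`exists_hasWeakSpatialGradientOn_of_lintegral_fderiv_le`):
  bounded dissipation of the `Vₙ` on an open region produces a weak spatial gradient of `v`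
  there with the Fatou bound;
* here: (i) a cut-off `φ = 1` on `[-9/16, 0] × 𝒞̄(3/4)` supported in `]-3/4, 1[ × 𝒞(7/8)` and its
  margins inside `Q` below every `t < 0` (`exists_cutoff`); (ii) local dissipation bounds on
  every compact `K ⊆ Q` (`exists_eventually_lintegral_fderiv_le_of_isCompact`), weak gradients
  on an exhaustion of `Q` glued by `exists_hasWeakSpatialGradientOn_of_exhaustion`; (iii) the
  sharp bound on `]-9/16, -1/m[ × 𝒞(3/4)` transferred to the glued gradient by a.e. uniqueness
  (`HasWeakSpatialGradientOn.ae_eq`) and monotone convergence `m → ∞` for `E(0, 3/4)`;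
  (iv) `A(0, 3/4)`: along a subsequence `Vₙ(t, ·) → v(t, ·)` in `L²` for a.e. `t`
  (`exists_subseq_tendsto_eLpNorm_slice`), so `∫_{𝒞(3/4)} |v(t)|² ≤ M` for a.e. `t ∈ ]-9/16, 0[`.

## References

* G. Seregin, V. Šverák, Comm. PDE 34 (2009) 171–201, arXiv:0804.1803: §2 Def. 2.2 and p. 6,
  §3 Remark 3.4, Lemma 3.5 and its proof, (as6) (pp. 9–10). [`SereginSverak2009`]
* L. Caffarelli, R. Kohn, L. Nirenberg, CPAM 35 (1982), §2 (suitable weak solutions).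
-/

noncomputable section

open MeasureTheory TopologicalSpace Set Function Filter Metric
open scoped RealInnerProductSpace ENNReal NNReal Topology Manifold

namespace Literature.Analysis.FluidPDE

namespace SereginSverak2009

/-! ### A smooth Urysohn cut-off -/

/-- Smooth Urysohn function for a compact set inside an open set of a finite-dimensional space
(Mathlib's `exists_contMDiffMap_zero_one_of_isClosed` for `K` and the complement of a
thickening of `K`). [folklore] -/
private theorem exists_smooth_cutoff {F : Type*} [NormedAddCommGroup F] [NormedSpace ℝ F]
    [FiniteDimensional ℝ F] {K U : Set F} (hK : IsCompact K) (hU : IsOpen U) (hKU : K ⊆ U) :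
    ∃ χ : F → ℝ, ContDiff ℝ (⊤ : ℕ∞) χ ∧ HasCompactSupport χ ∧ tsupport χ ⊆ U ∧ EqOn χ 1 K ∧
      ∀ x, χ x ∈ Icc (0 : ℝ) 1 := by
  obtain ⟨δ, hδ, hδU⟩ := hK.exists_cthickening_subset_open hU hKU
  obtain ⟨f, hf0, hf1, hf01⟩ := exists_contMDiffMap_zero_one_of_isClosed (I := 𝓘(ℝ, F))
    (M := F) (n := ⊤) (isClosed_compl_iff.2 isOpen_thickening) hK.isClosed
    (disjoint_compl_left_iff_subset.2 (self_subset_thickening hδ K))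
  have hsupp : support f ⊆ thickening δ K := fun x hx => by
    by_contra h
    exact hx (hf0 h)
  have htsupp : tsupport f ⊆ cthickening δ K :=
    (closure_mono hsupp).trans (closure_thickening_subset_cthickening δ K)
  refine ⟨f, contMDiff_iff_contDiff.1 f.contMDiff, ?_, htsupp.trans hδU, hf1, hf01⟩
  exact IsCompact.of_isClosed_subset hK.cthickening (isClosed_tsupport _) htsupp

/-! ### Geometry of the unit cylinder -/

/-- The unit cylinder as a set: `Q = {(t, x) : -1 < t < 0, |x'| < 1, |x₃| < 1}`.
[cite: SereginSverak2009, §3 (arXiv p. 9)] -/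
theorem coe_parCylOpens_zero_one :
    ((parCylOpens (0 : ℝ × EuclideanSpace ℝ (Fin 3)) 1 : Opens (ℝ × EuclideanSpace ℝ (Fin 3))) : Set (ℝ × EuclideanSpace ℝ (Fin 3))) =
      {z | z.1 ∈ Ioo (-1 : ℝ) 0 ∧ cylRadius z.2 < 1 ∧ |z.2 2| < 1} := by
  ext z
  rw [coe_parCylOpens]
  simp [mem_parCyl_zero]

/-- Coordinates are bounded by the distance to the axis: `|x₀| ≤ |x'|`. [folklore] -/
theorem abs_apply_zero_le_cylRadius (x : (EuclideanSpace ℝ (Fin 3))) : |x 0| ≤ cylRadius x := by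
  rw [← Real.sqrt_sq_eq_abs, cylRadius]
  exact Real.sqrt_le_sqrt (by nlinarith [sq_nonneg (x 1)])

/-- Coordinates are bounded by the distance to the axis: `|x₁| ≤ |x'|`. [folklore] -/
theorem abs_apply_one_le_cylRadius (x : (EuclideanSpace ℝ (Fin 3))) : |x 1| ≤ cylRadius x := by
  rw [← Real.sqrt_sq_eq_abs, cylRadius]
  exact Real.sqrt_le_sqrt (by nlinarith [sq_nonneg (x 0)])

/-- The squared norm on `ℝ³` in coordinates. [folklore] -/
theorem norm_sq_eq_three (x : (EuclideanSpace ℝ (Fin 3))) : ‖x‖ ^ 2 = x 0 ^ 2 + x 1 ^ 2 + x 2 ^ 2 := by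
  rw [EuclideanSpace.norm_sq_eq, Fin.sum_univ_three]
  simp [Real.norm_eq_abs, sq_abs]

/-- Points of a cylinder `{|x'| < R, |x₃| < R}` satisfy `‖x‖² < 2R²`. [folklore] -/
theorem norm_sq_lt_of_cyl {x : (EuclideanSpace ℝ (Fin 3))} {R : ℝ} (hr : cylRadius x < R) (h3 : |x 2| < R) :
    ‖x‖ ^ 2 < 2 * R ^ 2 := by
  have hc : cylRadius x ^ 2 < R ^ 2 := pow_lt_pow_left₀ hr (cylRadius_nonneg x) two_ne_zero
  have h2 : x 2 ^ 2 < R ^ 2 := by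
    rw [← sq_abs]; exact pow_lt_pow_left₀ h3 (abs_nonneg _) two_ne_zero
  rw [norm_sq_eq_three, ← cylRadius_sq]
  linarith

/-- The unit cylinder is bounded. [folklore] -/
theorem isBounded_parCyl_zero_one : Bornology.IsBounded (parCyl (0 : ℝ × EuclideanSpace ℝ (Fin 3)) 1) := by
  rw [Metric.isBounded_iff_subset_closedBall (0 : ℝ × EuclideanSpace ℝ (Fin 3))]
  refine ⟨2, fun z hz => ?_⟩
  rw [mem_parCyl_zero] at hz
  obtain ⟨⟨h1, h2⟩, hr, h3⟩ := hz
  rw [mem_closedBall, Prod.dist_eq, Prod.fst_zero, Prod.snd_zero, dist_zero_right, dist_zero_right,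
    max_le_iff]
  refine ⟨?_, ?_⟩
  · rw [Real.norm_eq_abs, abs_le]; constructor <;> nlinarith
  · have hsq := norm_sq_lt_of_cyl hr h3
    nlinarith [norm_nonneg z.2]

/-! ### The cut-off of the proof of (as6) -/

set_option maxHeartbeats 400000 in
/-- **The cut-off.** A smooth space–time test function `φ : ℝ × ℝ³ → [0, 1]` with
`φ = 1` on `[-9/16, 1/2] × 𝒞̄(3/4)`, `φ(-1, ·) = 0`, whose support stays inside the unit
cylinder `Q` with a uniform margin below every time `t < 0`: for `t < 0` there is `δ > 0` with
`closedBall z δ ⊆ Q` for all `z ∈ supp φ` with `z.1 ≤ t` (the support lies in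
`]-3/4, 1[ × 𝒞(7/8)`). [folklore] -/
theorem exists_cutoff : ∃ φ : ℝ → (EuclideanSpace ℝ (Fin 3)) → ℝ, IsSpaceTimeTestOn (⊤ : Opens (ℝ × EuclideanSpace ℝ (Fin 3))) φ ∧
    (∀ s y, 0 ≤ φ s y) ∧ (∀ s y, φ s y ≤ 1) ∧ (∀ y, φ (-1) y = 0) ∧
    (∀ s ∈ Icc (-(9 : ℝ) / 16) (1 / 2), ∀ y, cylRadius y ≤ 3 / 4 → |y 2| ≤ 3 / 4 → φ s y = 1) ∧
    ∀ t < (0 : ℝ), ∃ δ > (0 : ℝ), ∀ z ∈ tsupport (uncurry φ), z.1 ≤ t →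
      closedBall z δ ⊆ parCyl (0 : ℝ × EuclideanSpace ℝ (Fin 3)) 1 := by
  -- the compact set and the open set
  set K : Set (ℝ × EuclideanSpace ℝ (Fin 3)) := Icc (-(9 : ℝ) / 16) (1 / 2) ×ˢ {y | cylRadius y ≤ 3 / 4 ∧ |y 2| ≤ 3 / 4}
    with hK
  set U : Set (ℝ × EuclideanSpace ℝ (Fin 3)) := Ioo (-(3 : ℝ) / 4) 1 ×ˢ {y | cylRadius y < 7 / 8 ∧ |y 2| < 7 / 8} with hU
  have hc2 : Continuous fun y : (EuclideanSpace ℝ (Fin 3)) => |y 2| := by fun_prop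
  have hKc : IsCompact K := by
    refine isCompact_Icc.prod ?_
    have hcl : IsClosed {y : (EuclideanSpace ℝ (Fin 3)) | cylRadius y ≤ 3 / 4 ∧ |y 2| ≤ 3 / 4} :=
      (isClosed_le continuous_cylRadius continuous_const).inter (isClosed_le hc2 continuous_const)
    refine Metric.isCompact_of_isClosed_isBounded hcl ?_
    rw [Metric.isBounded_iff_subset_closedBall (0 : (EuclideanSpace ℝ (Fin 3)))]
    refine ⟨2, fun y hy => ?_⟩
    obtain ⟨hr, h3⟩ := hy
    rw [mem_closedBall, dist_zero_right]
    have hsq := norm_sq_lt_of_cyl (show cylRadius y < 1 by change cylRadius y ≤ 3 / 4 at hr; linarith)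
      (show |y 2| < 1 by change |y 2| ≤ 3 / 4 at h3; linarith)
    nlinarith [norm_nonneg y]
  have hUo : IsOpen U := isOpen_Ioo.prod
    ((isOpen_lt continuous_cylRadius continuous_const).inter (isOpen_lt hc2 continuous_const))
  have hKU : K ⊆ U := by
    rintro ⟨s, y⟩ ⟨⟨hs1, hs2⟩, hr, h3⟩
    exact ⟨⟨by linarith, by linarith⟩, by
      change cylRadius y ≤ 3 / 4 at hr; change cylRadius y < 7 / 8; linarith, by
      change |y 2| ≤ 3 / 4 at h3; change |y 2| < 7 / 8; linarith⟩
  obtain ⟨χ, hχ, hχc, hχU, hχ1, hχ01⟩ := exists_smooth_cutoff hKc hUo hKU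
  refine ⟨curry χ, ⟨hχ, hχc, fun _ _ => trivial⟩, fun s y => (hχ01 (s, y)).1,
    fun s y => (hχ01 (s, y)).2, fun y => ?_, fun s hs y hr h3 => hχ1 ⟨hs, hr, h3⟩, fun t ht => ?_⟩
  · -- `φ(-1, ·) = 0`
    have h : ((-1 : ℝ), y) ∉ tsupport χ := fun h => by
      have := (hχU h).1.1; norm_num at this
    show χ ((-1 : ℝ), y) = 0
    exact image_eq_zero_of_notMem_tsupport h
  · -- the margin below time `t < 0`
    refine ⟨min (1 / 16) (-t / 2), lt_min (by norm_num) (by linarith), fun z hz hzt w hw => ?_⟩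
    have hzU : z ∈ U := hχU hz
    obtain ⟨⟨hz1, -⟩, hzr, hz3⟩ := hzU
    rw [mem_closedBall, Prod.dist_eq, max_le_iff] at hw
    obtain ⟨hw1, hw2⟩ := hw
    rw [Real.dist_eq] at hw1
    have hδ1 : min (1 / 16 : ℝ) (-t / 2) ≤ 1 / 16 := min_le_left _ _
    have hδ2 : min (1 / 16 : ℝ) (-t / 2) ≤ -t / 2 := min_le_right _ _
    rw [mem_parCyl_zero]
    refine ⟨⟨?_, ?_⟩, ?_, ?_⟩
    · have := (abs_le.1 (hw1.trans hδ1)).1; nlinarith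
    · have := (abs_le.1 (hw1.trans hδ2)).2; nlinarith
    · -- the distance to the axis
      rw [dist_eq_norm] at hw2
      have hd : ‖w.2 - z.2‖ ≤ 1 / 16 := hw2.trans hδ1
      have e0 : |w.2 0 - z.2 0| ≤ 1 / 16 := by
        have := PiLp.norm_apply_le (w.2 - z.2) 0
        rw [Real.norm_eq_abs] at this
        simpa using this.trans hd
      have e1 : |w.2 1 - z.2 1| ≤ 1 / 16 := by
        have := PiLp.norm_apply_le (w.2 - z.2) 1
        rw [Real.norm_eq_abs] at this
        simpa using this.trans hd
      have a0 := abs_apply_zero_le_cylRadius z.2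
      have a1 := abs_apply_one_le_cylRadius z.2
      change cylRadius z.2 < 7 / 8 at hzr
      have hsq : (w.2 0) ^ 2 + (w.2 1) ^ 2 < 1 := by
        have b0 : |w.2 0| ≤ |z.2 0| + 1 / 16 := by
          calc |w.2 0| = |z.2 0 + (w.2 0 - z.2 0)| := by ring_nf
            _ ≤ |z.2 0| + |w.2 0 - z.2 0| := abs_add_le _ _
            _ ≤ |z.2 0| + 1 / 16 := by linarith
        have b1 : |w.2 1| ≤ |z.2 1| + 1 / 16 := by
          calc |w.2 1| = |z.2 1 + (w.2 1 - z.2 1)| := by ring_nf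
            _ ≤ |z.2 1| + |w.2 1 - z.2 1| := abs_add_le _ _
            _ ≤ |z.2 1| + 1 / 16 := by linarith
        have c0 : (w.2 0) ^ 2 ≤ (|z.2 0| + 1 / 16) ^ 2 := by
          rw [← sq_abs (w.2 0)]; exact pow_le_pow_left₀ (abs_nonneg _) b0 2
        have c1 : (w.2 1) ^ 2 ≤ (|z.2 1| + 1 / 16) ^ 2 := by
          rw [← sq_abs (w.2 1)]; exact pow_le_pow_left₀ (abs_nonneg _) b1 2
        have c0' : (w.2 0) ^ 2 ≤ |z.2 0| ^ 2 + |z.2 0| / 8 + 1 / 256 := by nlinarith only [c0]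
        have c1' : (w.2 1) ^ 2 ≤ |z.2 1| ^ 2 + |z.2 1| / 8 + 1 / 256 := by nlinarith only [c1]
        have hzsq : |z.2 0| ^ 2 + |z.2 1| ^ 2 = cylRadius z.2 ^ 2 := by
          rw [cylRadius_sq, sq_abs, sq_abs]
        have hcr2 : cylRadius z.2 ^ 2 < (7 / 8) ^ 2 :=
          pow_lt_pow_left₀ hzr (cylRadius_nonneg _) two_ne_zero
        linarith only [c0', c1', hzsq, hcr2, a0, a1, hzr]
      calc cylRadius w.2 = Real.sqrt ((w.2 0) ^ 2 + (w.2 1) ^ 2) := rfl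
        _ < 1 := by
          rw [show (1 : ℝ) = Real.sqrt 1 from Real.sqrt_one.symm]
          exact Real.sqrt_lt_sqrt (by positivity) hsq
    · rw [dist_eq_norm] at hw2
      have hd : ‖w.2 - z.2‖ ≤ 1 / 16 := hw2.trans hδ1
      have e2 : |w.2 2 - z.2 2| ≤ 1 / 16 := by
        have := PiLp.norm_apply_le (w.2 - z.2) 2
        rw [Real.norm_eq_abs] at this
        simpa using this.trans hd
      change |z.2 2| < 7 / 8 at hz3
      calc |w.2 2| = |z.2 2 + (w.2 2 - z.2 2)| := by ring_nf
        _ ≤ |z.2 2| + |w.2 2 - z.2 2| := abs_add_le _ _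
        _ < 1 := by linarith

/-! ### Local dissipation bounds for the mollified velocity -/

section Analytic

variable {u : ℝ → (EuclideanSpace ℝ (Fin 3)) → (EuclideanSpace ℝ (Fin 3))} {p : ℝ → (EuclideanSpace ℝ (Fin 3)) → ℝ}

/-- **Bounded dissipation of the mollifications on compact subsets of `Q`.** Under the
standing assumptions and (r2), for every compact `K ⊆ Q` the space–time mollifications
`Vₙ = kₙ ⋆ 𝟙_Q v` have `∫∫_K |D Vₙ|² ≤ L` for all large `n` (a cut-off equal to `1` on `K`
supported in a thickening of `K` inside `Q`, and `exists_eventually_mollified_energy_le` at a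
time above `K`). [cite: SereginSverak2009, Remark 3.4 (with §2, p. 6)] -/
theorem exists_eventually_lintegral_fderiv_le_of_isCompact
    (hNS : IsDistributionalNSSolutionOn (parCylOpens (0 : ℝ × EuclideanSpace ℝ (Fin 3)) 1) 1 0 u p)
    (hu3 : ∫⁻ z in parCyl (0 : ℝ × EuclideanSpace ℝ (Fin 3)) 1, ‖u z.1 z.2‖ₑ ^ (3 : ℕ) < ∞)
    (hp : ∫⁻ z in parCyl (0 : ℝ × EuclideanSpace ℝ (Fin 3)) 1, ‖p z.1 z.2‖ₑ ^ (3 / 2 : ℝ) < ∞)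
    (hbd : IsBoundedAwayFromZero u)
    (bump : ℕ → ContDiffBump (0 : ℝ × EuclideanSpace ℝ (Fin 3))) (hbr : Tendsto (fun n => (bump n).rOut) atTop (𝓝 0))
    {K : Set (ℝ × EuclideanSpace ℝ (Fin 3))} (hK : IsCompact K) (hKQ : K ⊆ parCyl (0 : ℝ × EuclideanSpace ℝ (Fin 3)) 1) :
    ∃ L : ℝ, ∀ᶠ n in atTop, ∫⁻ z in K, ENNReal.ofReal (frobeniusNormSq (fderiv ℝ
      (stMollify ((bump n).normed volume) (zeroExt (parCylOpens (0 : ℝ × EuclideanSpace ℝ (Fin 3)) 1) u) z.1) z.2)) ≤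
      ENNReal.ofReal L := by
  haveI : (volume : Measure (ℝ × EuclideanSpace ℝ (Fin 3))).IsAddHaarMeasure := Measure.prod.instIsAddHaarMeasure _ _
  set Q : Opens (ℝ × EuclideanSpace ℝ (Fin 3)) := parCylOpens 0 1 with hQdef
  have hQ : (Q : Set (ℝ × EuclideanSpace ℝ (Fin 3))) = parCyl 0 1 := rfl
  set V : ℕ → ℝ → (EuclideanSpace ℝ (Fin 3)) → (EuclideanSpace ℝ (Fin 3)) := fun n => stMollify ((bump n).normed volume) (zeroExt Q u) with hV
  -- a margin `ε ≤ 1` with `cthickening ε K ⊆ Q`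
  obtain ⟨ε₀, hε₀, hε₀Q⟩ := hK.exists_cthickening_subset_open (isOpen_parCyl 0 1) hKQ
  set ε : ℝ := min ε₀ 1 with hε
  have hε0 : 0 < ε := lt_min hε₀ one_pos
  have hε1 : ε ≤ 1 := min_le_right _ _
  have hεQ : cthickening ε K ⊆ parCyl (0 : ℝ × EuclideanSpace ℝ (Fin 3)) 1 :=
    (cthickening_mono (min_le_left _ _) K).trans hε₀Q
  -- the cut-off
  obtain ⟨χ, hχ, hχc, hχU, hχ1, hχ01⟩ := exists_smooth_cutoff hK (isOpen_thickening (δ := ε / 2))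
    (self_subset_thickening (half_pos hε0) K)
  have hsuppχ : tsupport χ ⊆ cthickening (ε / 2) K :=
    hχU.trans (thickening_subset_cthickening _ _)
  have hball : ∀ z ∈ tsupport χ, closedBall z (ε / 2) ⊆ parCyl (0 : ℝ × EuclideanSpace ℝ (Fin 3)) 1 := by
    intro z hz
    refine ((closedBall_subset_cthickening (hsuppχ hz) (ε / 2)).trans ?_).trans hεQ
    have h := cthickening_cthickening_subset (half_pos hε0).le (half_pos hε0).le K
    rwa [add_halves] at h
  have htime : ∀ z ∈ tsupport χ, z.1 + ε / 2 < 0 := by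
    intro z hz
    have hmem : ((z.1 + ε / 2, z.2) : ℝ × EuclideanSpace ℝ (Fin 3)) ∈ closedBall z (ε / 2) := by
      rw [mem_closedBall, Prod.dist_eq, dist_self, Real.dist_eq]
      simp [abs_of_pos (half_pos hε0), (half_pos hε0).le]
    have := (hball z hz hmem).1.2
    simpa using this
  set φ : ℝ → (EuclideanSpace ℝ (Fin 3)) → ℝ := curry χ with hφdef
  have hφ : IsSpaceTimeTestOn (⊤ : Opens (ℝ × EuclideanSpace ℝ (Fin 3))) φ := ⟨hχ, hχc, fun _ _ => trivial⟩
  have hφ0 : ∀ s y, 0 ≤ φ s y := fun s y => (hχ01 (s, y)).1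
  have hφa : ∀ y, φ (-1) y = 0 := by
    intro y
    have h : ((-1 : ℝ), y) ∉ tsupport χ := fun h => by
      have h2 := (hball _ h (mem_closedBall_self (half_pos hε0).le)).1.1
      norm_num at h2
    show χ ((-1 : ℝ), y) = 0
    exact image_eq_zero_of_notMem_tsupport h
  -- the uniform bound of `LocalEnergyMollifiedBounds` at time `t = -ε/2` with margin `ε/4`
  have hu3' : ∫⁻ z in (Q : Set (ℝ × EuclideanSpace ℝ (Fin 3))), ‖u z.1 z.2‖ₑ ^ (3 : ℕ) < ∞ := by rw [hQ]; exact hu3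
  have hp' : ∫⁻ z in (Q : Set (ℝ × EuclideanSpace ℝ (Fin 3))), ‖p z.1 z.2‖ₑ ^ (3 / 2 : ℝ) < ∞ := by rw [hQ]; exact hp
  obtain ⟨M, hM⟩ := exists_eventually_mollified_energy_le (by rw [hQ]; exact isBounded_parCyl_zero_one)
    one_pos hNS hu3' hp' hφ hφ0 hφa bump hbr
  set t : ℝ := -(ε / 2) with ht
  have hat : (-1 : ℝ) ≤ t := by rw [ht]; linarith
  have hgeo : ∀ z ∈ tsupport (uncurry φ), z.1 ≤ t → closedBall z (ε / 4) ⊆ (Q : Set (ℝ × EuclideanSpace ℝ (Fin 3))) :=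
    fun z hz _ => (closedBall_subset_closedBall (by linarith)).trans (hball z hz)
  have hKb : ∃ Kb : ℝ, ∀ᵐ z ∂(volume.restrict (Q : Set (ℝ × EuclideanSpace ℝ (Fin 3)))), z.1 < t + ε / 4 → ‖u z.1 z.2‖ ≤ Kb := by
    have ha : Real.sqrt (ε / 4) ∈ Ioo (0 : ℝ) 1 := by
      refine ⟨Real.sqrt_pos.2 (by positivity), ?_⟩
      rw [show (1 : ℝ) = Real.sqrt 1 from Real.sqrt_one.symm]
      exact Real.sqrt_lt_sqrt (by positivity) (by linarith)
    obtain ⟨Kb, hKb⟩ := hbd _ ha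
    refine ⟨Kb, ?_⟩
    rw [hQ]
    filter_upwards [hKb] with z hz hzt
    refine hz ?_
    rw [Real.sq_sqrt (by positivity)]
    rw [ht] at hzt
    linarith
  have hev := hM t hat (ε / 4) (by positivity) hgeo hKb
  -- `K` lies in the slab `(-1, t) × ℝ³` and `φ = 1` on `K`
  have hKslab : K ⊆ Ioo (-1 : ℝ) t ×ˢ (univ : Set (EuclideanSpace ℝ (Fin 3))) := by
    intro z hz
    refine ⟨⟨?_, ?_⟩, mem_univ _⟩
    · have := (hKQ hz).1.1; simpa using this
    · have hzs : z ∈ tsupport χ := subset_tsupport _ (by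
        rw [Function.mem_support, hχ1 hz]; exact one_ne_zero)
      have := htime z hzs
      rw [ht]; linarith
  have hφK : ∀ z ∈ K, φ z.1 z.2 = 1 := fun z hz => hχ1 hz
  -- continuity of the dissipation density
  have hũi : LocallyIntegrable (zeroExt Q u) volume := by
    refine locallyIntegrable_zeroExt ?_
    haveI : IsFiniteMeasure (volume.restrict (Q : Set (ℝ × EuclideanSpace ℝ (Fin 3)))) :=
      ⟨by rw [Measure.restrict_apply_univ, hQ]; exact isBounded_parCyl_zero_one.measure_lt_top⟩
    have hvm : AEStronglyMeasurable (uncurry u) (volume.restrict (Q : Set (ℝ × EuclideanSpace ℝ (Fin 3)))) :=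
      hNS.1.aestronglyMeasurable
    have hv3Q : MemLp (uncurry u) 3 (volume.restrict (Q : Set (ℝ × EuclideanSpace ℝ (Fin 3)))) := by
      have := memLp_nat_of_lintegral_lt_top hvm (n := 3) (by norm_num) (by exact hu3')
      simpa using this
    exact hv3Q.integrable (by norm_num)
  have hVsm : ∀ n, ContDiff ℝ (⊤ : ℕ∞) (uncurry (V n)) := fun n =>
    contDiff_uncurry_stMollify (bump n).contDiff_normed (bump n).hasCompactSupport_normed hũi
  have cF : ∀ n, Continuous fun z : ℝ × EuclideanSpace ℝ (Fin 3) => frobeniusNormSq (fderiv ℝ (V n z.1) z.2) := by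
    intro n
    have sV : IsSmoothSpaceTimeOn univ (V n) := (hVsm n).contDiffOn
    exact LerayHopfProofs.continuous_frobeniusNormSq.comp
      (sV.fderiv_slice uniqueDiffOn_univ).continuous_uncurry
  obtain ⟨Kx, hKx, hKxt⟩ := hφ.exists_compact_slice_subset
  have hφKx : ∀ s, ∀ y ∉ Kx, φ s y = 0 := fun s y hy =>
    image_eq_zero_of_notMem_tsupport fun h => hy (hKxt s h)
  have cφ : Continuous (uncurry φ) := hφ.contDiff.continuous
  refine ⟨M / 2, ?_⟩
  filter_upwards [hev] with n hn
  set F : ℝ × EuclideanSpace ℝ (Fin 3) → ℝ := fun z => φ z.1 z.2 * frobeniusNormSq (fderiv ℝ (V n z.1) z.2) with hF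
  have iF : IntegrableOn F (Ioo (-1 : ℝ) t ×ˢ (univ : Set (EuclideanSpace ℝ (Fin 3)))) volume :=
    integrableOn_slab_of_continuous hKx (cφ.mul (cF n)) fun s y hy => by
      simp only [hF, hφKx s y hy, zero_mul]
  have hFnn : ∀ z, 0 ≤ F z := fun z => mul_nonneg (hφ0 z.1 z.2) (frobeniusNormSq_nonneg _)
  have hL0 : 0 ≤ ∫ y, φ t y * ‖V n t y‖ ^ 2 :=
    integral_nonneg fun y => mul_nonneg (hφ0 t y) (sq_nonneg _)
  have hGd : ∫ z in Ioo (-1 : ℝ) t ×ˢ (univ : Set (EuclideanSpace ℝ (Fin 3))), F z ≤ M / 2 := by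
    have h := hn
    change (∫ y, φ t y * ‖V n t y‖ ^ 2) + 2 * 1 * ∫ z in Ioo (-1 : ℝ) t ×ˢ (univ : Set (EuclideanSpace ℝ (Fin 3))), F z ≤ M at h
    linarith
  calc ∫⁻ z in K, ENNReal.ofReal (frobeniusNormSq (fderiv ℝ (V n z.1) z.2))
      = ∫⁻ z in K, ENNReal.ofReal (F z) := by
        refine setLIntegral_congr_fun hK.measurableSet fun z hz => ?_
        simp only [hF, hφK z hz, one_mul]
    _ ≤ ∫⁻ z in Ioo (-1 : ℝ) t ×ˢ (univ : Set (EuclideanSpace ℝ (Fin 3))), ENNReal.ofReal (F z) :=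
        lintegral_mono_set hKslab
    _ = ENNReal.ofReal (∫ z in Ioo (-1 : ℝ) t ×ˢ (univ : Set (EuclideanSpace ℝ (Fin 3))), F z) :=
        (ofReal_integral_eq_lintegral_ofReal iF (Eventually.of_forall hFnn)).symm
    _ ≤ ENNReal.ofReal (M / 2) := ENNReal.ofReal_le_ofReal hGd

/-- `L¹(K)` convergence on compact subsets of `Q` of the mollified velocity, from its `L²`
convergence on space–time (Cauchy–Schwarz on a set of finite measure). [folklore] -/
theorem tendsto_eLpNorm_one_restrict_of_tendsto_eLpNorm_two {Q : Opens (ℝ × EuclideanSpace ℝ (Fin 3))}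
    {v : ℝ → (EuclideanSpace ℝ (Fin 3)) → (EuclideanSpace ℝ (Fin 3))} {W : ℕ → ℝ × EuclideanSpace ℝ (Fin 3) → (EuclideanSpace ℝ (Fin 3))}
    (hW : ∀ n, AEStronglyMeasurable (W n) volume) (hv : AEStronglyMeasurable (zeroExt Q v) volume)
    (h : Tendsto (fun n => eLpNorm (W n - zeroExt Q v) 2 volume) atTop (𝓝 0))
    {K : Set (ℝ × EuclideanSpace ℝ (Fin 3))} (hK : IsCompact K) (hKQ : K ⊆ (Q : Set (ℝ × EuclideanSpace ℝ (Fin 3)))) :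
    Tendsto (fun n => eLpNorm (fun z => W n z - uncurry v z) 1 (volume.restrict K)) atTop (𝓝 0) := by
  have hKfin : volume K < ∞ := hK.measure_lt_top
  set C : ℝ≥0∞ := (volume.restrict K) univ ^ (1 / (1 : ℝ≥0∞).toReal - 1 / (2 : ℝ≥0∞).toReal) with hC
  have hCfin : C ≠ ∞ := by
    rw [hC, Measure.restrict_apply_univ]
    exact ENNReal.rpow_ne_top_of_nonneg (by norm_num) hKfin.ne
  have hle : ∀ n, eLpNorm (fun z => W n z - uncurry v z) 1 (volume.restrict K) ≤
      eLpNorm (W n - zeroExt Q v) 2 volume * C := by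
    intro n
    have e : eLpNorm (fun z => W n z - uncurry v z) 1 (volume.restrict K) =
        eLpNorm (W n - zeroExt Q v) 1 (volume.restrict K) := by
      refine eLpNorm_congr_ae ?_
      filter_upwards [ae_restrict_mem hK.measurableSet] with z hz
      rw [Pi.sub_apply, zeroExt_of_mem _ (hKQ hz)]; rfl
    rw [e]
    calc eLpNorm (W n - zeroExt Q v) 1 (volume.restrict K)
        ≤ eLpNorm (W n - zeroExt Q v) 2 (volume.restrict K) * C :=
          eLpNorm_le_eLpNorm_mul_rpow_measure_univ (by norm_num) ((hW n).sub hv).restrict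
      _ ≤ eLpNorm (W n - zeroExt Q v) 2 volume * C :=
          mul_le_mul_left (eLpNorm_mono_measure (W n - zeroExt Q v) Measure.restrict_le_self) C
  have hlim : Tendsto (fun n => eLpNorm (W n - zeroExt Q v) 2 volume * C) atTop (𝓝 0) := by
    have := ENNReal.Tendsto.mul_const h (Or.inr hCfin)
    rwa [zero_mul] at this
  exact tendsto_of_tendsto_of_tendsto_of_le_of_le tendsto_const_nhds hlim (fun n => zero_le) hle

/-- **Weak spatial gradient on an open subregion with bounded mollified dissipation**: if on an
open `Ω ⊆ Q` the mollifications satisfy `∫∫_Ω |D Vₙ|² ≤ L` for all large `n`, then `v` has a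
weak spatial gradient `G` on `Ω` with `∫∫_Ω |G|² ≤ L`
(`exists_hasWeakSpatialGradientOn_of_lintegral_fderiv_le` along the tail of the sequence). [folklore] -/
theorem exists_hasWeakSpatialGradientOn_of_eventually
    (hNS : IsDistributionalNSSolutionOn (parCylOpens (0 : ℝ × EuclideanSpace ℝ (Fin 3)) 1) 1 0 u p)
    (hu3 : ∫⁻ z in parCyl (0 : ℝ × EuclideanSpace ℝ (Fin 3)) 1, ‖u z.1 z.2‖ₑ ^ (3 : ℕ) < ∞)
    (bump : ℕ → ContDiffBump (0 : ℝ × EuclideanSpace ℝ (Fin 3))) (hbr : Tendsto (fun n => (bump n).rOut) atTop (𝓝 0))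
    {Ω : Opens (ℝ × EuclideanSpace ℝ (Fin 3))} (hΩ : (Ω : Set (ℝ × EuclideanSpace ℝ (Fin 3))) ⊆ parCyl (0 : ℝ × EuclideanSpace ℝ (Fin 3)) 1) {L : ℝ}
    (hL : ∀ᶠ n in atTop, ∫⁻ z in (Ω : Set (ℝ × EuclideanSpace ℝ (Fin 3))), ENNReal.ofReal (frobeniusNormSq (fderiv ℝ
      (stMollify ((bump n).normed volume) (zeroExt (parCylOpens (0 : ℝ × EuclideanSpace ℝ (Fin 3)) 1) u) z.1) z.2)) ≤
      ENNReal.ofReal L) :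
    ∃ G : ℝ → (EuclideanSpace ℝ (Fin 3)) → (EuclideanSpace ℝ (Fin 3)) →L[ℝ] (EuclideanSpace ℝ (Fin 3)), HasWeakSpatialGradientOn Ω u G ∧
      ∫⁻ z in (Ω : Set (ℝ × EuclideanSpace ℝ (Fin 3))), ENNReal.ofReal (frobeniusNormSq (G z.1 z.2)) ≤ ENNReal.ofReal L := by
  haveI : (volume : Measure (ℝ × EuclideanSpace ℝ (Fin 3))).IsAddHaarMeasure := Measure.prod.instIsAddHaarMeasure _ _
  set Q : Opens (ℝ × EuclideanSpace ℝ (Fin 3)) := parCylOpens 0 1 with hQdef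
  have hQ : (Q : Set (ℝ × EuclideanSpace ℝ (Fin 3))) = parCyl 0 1 := rfl
  have hQm : MeasurableSet (Q : Set (ℝ × EuclideanSpace ℝ (Fin 3))) := Q.isOpen.measurableSet
  set V : ℕ → ℝ → (EuclideanSpace ℝ (Fin 3)) → (EuclideanSpace ℝ (Fin 3)) := fun n => stMollify ((bump n).normed volume) (zeroExt Q u) with hV
  -- classes of `u` and the `L²` convergence of the mollifications
  haveI : IsFiniteMeasure (volume.restrict (Q : Set (ℝ × EuclideanSpace ℝ (Fin 3)))) :=
    ⟨by rw [Measure.restrict_apply_univ, hQ]; exact isBounded_parCyl_zero_one.measure_lt_top⟩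
  have hvm : AEStronglyMeasurable (uncurry u) (volume.restrict (Q : Set (ℝ × EuclideanSpace ℝ (Fin 3)))) :=
    hNS.1.aestronglyMeasurable
  have hv3Q : MemLp (uncurry u) 3 (volume.restrict (Q : Set (ℝ × EuclideanSpace ℝ (Fin 3)))) := by
    have hu3' : ∫⁻ z in (Q : Set (ℝ × EuclideanSpace ℝ (Fin 3))), ‖u z.1 z.2‖ₑ ^ (3 : ℕ) < ∞ := by rw [hQ]; exact hu3
    have := memLp_nat_of_lintegral_lt_top hvm (n := 3) (by norm_num) (by exact hu3')
    simpa using this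
  have hv2Q : MemLp (uncurry u) 2 (volume.restrict (Q : Set (ℝ × EuclideanSpace ℝ (Fin 3)))) :=
    hv3Q.mono_exponent (by norm_num)
  have hũ2 : MemLp (zeroExt Q u) 2 volume := memLp_zeroExt rfl hQm hv2Q
  have hũi : LocallyIntegrable (zeroExt Q u) volume :=
    locallyIntegrable_zeroExt (hv2Q.integrable one_le_two)
  have hVsm : ∀ n, ContDiff ℝ (⊤ : ℕ∞) (uncurry (V n)) := fun n =>
    contDiff_uncurry_stMollify (bump n).contDiff_normed (bump n).hasCompactSupport_normed hũi
  have mV2 : ∀ n, MemLp (uncurry (V n)) 2 volume := fun n =>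
    UnboundedOperators.memLp_convolution_lsmul (bump n).integrable_normed hũ2 (by norm_num)
  have cV2 : Tendsto (fun n => eLpNorm (uncurry (V n) - zeroExt Q u) 2 volume) atTop (𝓝 0) :=
    FunctionSpaces.tendsto_eLpNorm_normed_convolution_sub_self hbr (by norm_num) (by norm_num) hũ2
  -- the tail of the sequence
  obtain ⟨n₀, hn₀⟩ := eventually_atTop.1 hL
  set W : ℕ → ℝ → (EuclideanSpace ℝ (Fin 3)) → (EuclideanSpace ℝ (Fin 3)) := fun k => V (k + n₀) with hW
  have hWc : ∀ k, ContDiff ℝ 1 (uncurry (W k)) := fun k => (hVsm (k + n₀)).of_le (by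
    exact_mod_cast le_top)
  have hconv : ∀ K ⊆ (Ω : Set (ℝ × EuclideanSpace ℝ (Fin 3))), IsCompact K →
      Tendsto (fun k => eLpNorm (fun z => uncurry (W k) z - uncurry u z) 1 (volume.restrict K))
        atTop (𝓝 0) := by
    intro K hKΩ hK
    have h := tendsto_eLpNorm_one_restrict_of_tendsto_eLpNorm_two (fun n => (mV2 n).1) hũ2.1 cV2 hK
      (hKΩ.trans hΩ)
    exact h.comp (tendsto_add_atTop_nat n₀)
  have hbd : ∀ k, ∫⁻ z in (Ω : Set (ℝ × EuclideanSpace ℝ (Fin 3))),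
      ENNReal.ofReal (frobeniusNormSq (fderiv ℝ (W k z.1) z.2)) ≤ ENNReal.ofReal L := fun k =>
    hn₀ (k + n₀) (Nat.le_add_left _ _)
  exact exists_hasWeakSpatialGradientOn_of_lintegral_fderiv_le (hNS.1.mono_set hΩ) hWc hconv
    ENNReal.ofReal_ne_top hbd

/-- The closed cylinder `[-1 + c, -c] × {|x'| ≤ 1 - c, |x₃| ≤ 1 - c}` is compact and, for `c > 0`,
contained in the unit cylinder. [folklore] -/
theorem isCompact_closedCyl (c : ℝ) : IsCompact (Icc (-1 + c) (-c) ×ˢ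
    {y : (EuclideanSpace ℝ (Fin 3)) | cylRadius y ≤ 1 - c ∧ |y 2| ≤ 1 - c}) := by
  refine isCompact_Icc.prod ?_
  have h3 : Continuous fun y : (EuclideanSpace ℝ (Fin 3)) => |y 2| := by fun_prop
  have hcl : IsClosed {y : (EuclideanSpace ℝ (Fin 3)) | cylRadius y ≤ 1 - c ∧ |y 2| ≤ 1 - c} :=
    (isClosed_le continuous_cylRadius continuous_const).inter (isClosed_le h3 continuous_const)
  refine Metric.isCompact_of_isClosed_isBounded hcl ?_
  rw [Metric.isBounded_iff_subset_closedBall (0 : (EuclideanSpace ℝ (Fin 3)))]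
  refine ⟨2 * |1 - c| + 2, fun y hy => ?_⟩
  obtain ⟨hr, h3'⟩ := hy
  rw [mem_closedBall, dist_zero_right]
  have hR : cylRadius y < |1 - c| + 1 := by
    change cylRadius y ≤ 1 - c at hr; linarith [le_abs_self (1 - c)]
  have hR' : |y 2| < |1 - c| + 1 := by
    change |y 2| ≤ 1 - c at h3'; linarith [le_abs_self (1 - c)]
  have hsq := norm_sq_lt_of_cyl hR hR'
  nlinarith [norm_nonneg y, abs_nonneg (1 - c)]

/-- **The velocity has a weak spatial gradient on the whole cylinder** (Seregin–Šverák 2009,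
Remark 3.4: `v ∈ W^{1,0}_2` locally in `Q`): weak gradients on the members of the exhaustion
`Qₘ = ]-1 + cₘ, -cₘ[ × {|x'| < 1 - cₘ, |x₃| < 1 - cₘ}`, `cₘ = 1/(m+3)`
(`exists_hasWeakSpatialGradientOn_of_eventually` fed by
`exists_eventually_lintegral_fderiv_le_of_isCompact`) glued by
`exists_hasWeakSpatialGradientOn_of_exhaustion`. [cite: SereginSverak2009, Remark 3.4] -/
theorem exists_hasWeakSpatialGradientOn_parCyl
    (hNS : IsDistributionalNSSolutionOn (parCylOpens (0 : ℝ × EuclideanSpace ℝ (Fin 3)) 1) 1 0 u p)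
    (hu3 : ∫⁻ z in parCyl (0 : ℝ × EuclideanSpace ℝ (Fin 3)) 1, ‖u z.1 z.2‖ₑ ^ (3 : ℕ) < ∞)
    (hp : ∫⁻ z in parCyl (0 : ℝ × EuclideanSpace ℝ (Fin 3)) 1, ‖p z.1 z.2‖ₑ ^ (3 / 2 : ℝ) < ∞)
    (hbd : IsBoundedAwayFromZero u)
    (bump : ℕ → ContDiffBump (0 : ℝ × EuclideanSpace ℝ (Fin 3))) (hbr : Tendsto (fun n => (bump n).rOut) atTop (𝓝 0)) :
    ∃ G : ℝ → (EuclideanSpace ℝ (Fin 3)) → (EuclideanSpace ℝ (Fin 3)) →L[ℝ] (EuclideanSpace ℝ (Fin 3)), HasWeakSpatialGradientOn (parCylOpens (0 : ℝ × EuclideanSpace ℝ (Fin 3)) 1) u G := by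
  -- the exhaustion `Qₘ = ]-1 + cₘ, -cₘ[ × {|x'| < 1 - cₘ, |x₃| < 1 - cₘ}`, `cₘ = 1/(m+3)`
  set c : ℕ → ℝ := fun m => 1 / ((m : ℝ) + 3) with hc
  have hc0 : ∀ m, 0 < c m := fun m => by simp only [hc]; positivity
  have hcmono : ∀ {m m' : ℕ}, m ≤ m' → c m' ≤ c m := fun {m m'} h => by
    simp only [hc]; gcongr
  set S : ℕ → Set (ℝ × EuclideanSpace ℝ (Fin 3)) := fun m =>
    {z | z.1 ∈ Ioo (-1 + c m) (-(c m)) ∧ cylRadius z.2 < 1 - c m ∧ |z.2 2| < 1 - c m} with hS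
  have hSo : ∀ m, IsOpen (S m) := fun m => by
    have h1 : Continuous fun z : ℝ × EuclideanSpace ℝ (Fin 3) => cylRadius z.2 := continuous_cylRadius.comp continuous_snd
    have h3 : Continuous fun z : ℝ × EuclideanSpace ℝ (Fin 3) => |z.2 2| := by fun_prop
    exact (isOpen_Ioo.preimage continuous_fst).inter
      ((isOpen_lt h1 continuous_const).inter (isOpen_lt h3 continuous_const))
  set Qn : ℕ → Opens (ℝ × EuclideanSpace ℝ (Fin 3)) := fun m => ⟨S m, hSo m⟩ with hQn
  have hmemQn : ∀ {m : ℕ} {z : ℝ × EuclideanSpace ℝ (Fin 3)}, z ∈ (Qn m : Set (ℝ × EuclideanSpace ℝ (Fin 3))) ↔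
      z.1 ∈ Ioo (-1 + c m) (-(c m)) ∧ cylRadius z.2 < 1 - c m ∧ |z.2 2| < 1 - c m :=
    fun {m z} => Iff.rfl
  have hQnQ : ∀ m, (Qn m : Set (ℝ × EuclideanSpace ℝ (Fin 3))) ⊆ parCyl (0 : ℝ × EuclideanSpace ℝ (Fin 3)) 1 := fun m z hz => by
    rw [hmemQn] at hz
    obtain ⟨⟨h1, h2⟩, hr, h3⟩ := hz
    have := hc0 m
    rw [mem_parCyl_zero]
    exact ⟨⟨by linarith, by linarith⟩, by linarith, by linarith⟩
  have hmono : Monotone Qn := by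
    intro m m' hmm' z hz
    rw [← SetLike.mem_coe, hmemQn] at hz ⊢
    obtain ⟨⟨h1, h2⟩, hr, h3⟩ := hz
    have := hcmono hmm'
    exact ⟨⟨by linarith, by linarith⟩, by linarith, by linarith⟩
  have hcov : ∀ K ⊆ ((parCylOpens (0 : ℝ × EuclideanSpace ℝ (Fin 3)) 1 : Opens (ℝ × EuclideanSpace ℝ (Fin 3))) : Set (ℝ × EuclideanSpace ℝ (Fin 3))), IsCompact K →
      ∃ m, K ⊆ (Qn m : Set (ℝ × EuclideanSpace ℝ (Fin 3))) := by
    intro K hKQ hK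
    refine hK.elim_directed_cover (fun m => (Qn m : Set (ℝ × EuclideanSpace ℝ (Fin 3)))) (fun m => (Qn m).isOpen) ?_
      (Monotone.directed_le fun m m' h => SetLike.coe_subset_coe.2 (hmono h))
    intro z hz
    have hz' : z ∈ parCyl (0 : ℝ × EuclideanSpace ℝ (Fin 3)) 1 := hKQ hz
    rw [mem_parCyl_zero] at hz'
    obtain ⟨⟨h1, h2⟩, hr, h3⟩ := hz'
    set μ : ℝ := min (min (z.1 + 1) (-z.1)) (min (1 - cylRadius z.2) (1 - |z.2 2|)) with hμ
    have hμ0 : 0 < μ := by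
      simp only [hμ, lt_min_iff]
      exact ⟨⟨by nlinarith, by linarith⟩, by linarith, by linarith⟩
    obtain ⟨m, hm⟩ := exists_nat_one_div_lt hμ0
    refine mem_iUnion.2 ⟨m, ?_⟩
    rw [hmemQn]
    have hcm : c m ≤ 1 / ((m : ℝ) + 1) := by simp only [hc]; gcongr; norm_num
    have hμ1 : μ ≤ z.1 + 1 := (min_le_left _ _).trans (min_le_left _ _)
    have hμ2 : μ ≤ -z.1 := (min_le_left _ _).trans (min_le_right _ _)
    have hμ3 : μ ≤ 1 - cylRadius z.2 := (min_le_right _ _).trans (min_le_left _ _)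
    have hμ4 : μ ≤ 1 - |z.2 2| := (min_le_right _ _).trans (min_le_right _ _)
    exact ⟨⟨by linarith, by linarith⟩, by linarith, by linarith⟩
  -- gradients on the exhaustion
  have hG : ∀ m, ∃ G : ℝ → (EuclideanSpace ℝ (Fin 3)) → (EuclideanSpace ℝ (Fin 3)) →L[ℝ] (EuclideanSpace ℝ (Fin 3)), HasWeakSpatialGradientOn (Qn m) u G := by
    intro m
    have hKc := isCompact_closedCyl (c m)
    have hKQ : Icc (-1 + c m) (-(c m)) ×ˢ {y : (EuclideanSpace ℝ (Fin 3)) | cylRadius y ≤ 1 - c m ∧ |y 2| ≤ 1 - c m} ⊆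
        parCyl (0 : ℝ × EuclideanSpace ℝ (Fin 3)) 1 := by
      rintro ⟨s, y⟩ ⟨⟨hs1, hs2⟩, hr, h3⟩
      change cylRadius y ≤ 1 - c m at hr
      change |y 2| ≤ 1 - c m at h3
      have := hc0 m
      rw [mem_parCyl_zero]
      exact ⟨⟨by simp only; linarith, by simp only; linarith⟩, by simp only; linarith,
        by simp only; linarith⟩
    obtain ⟨L, hL⟩ := exists_eventually_lintegral_fderiv_le_of_isCompact hNS hu3 hp hbd bump hbr
      hKc hKQ
    have hsub : (Qn m : Set (ℝ × EuclideanSpace ℝ (Fin 3))) ⊆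
        Icc (-1 + c m) (-(c m)) ×ˢ {y : (EuclideanSpace ℝ (Fin 3)) | cylRadius y ≤ 1 - c m ∧ |y 2| ≤ 1 - c m} := by
      intro z hz
      rw [hmemQn] at hz
      obtain ⟨⟨h1, h2⟩, hr, h3⟩ := hz
      exact ⟨⟨h1.le, h2.le⟩, hr.le, h3.le⟩
    have hL' : ∀ᶠ n in atTop, ∫⁻ z in (Qn m : Set (ℝ × EuclideanSpace ℝ (Fin 3))),
        ENNReal.ofReal (frobeniusNormSq (fderiv ℝ (stMollify ((bump n).normed volume)
          (zeroExt (parCylOpens (0 : ℝ × EuclideanSpace ℝ (Fin 3)) 1) u) z.1) z.2)) ≤ ENNReal.ofReal L :=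
      hL.mono fun n hn => (lintegral_mono_set hsub).trans hn
    obtain ⟨G, hG, -⟩ := exists_hasWeakSpatialGradientOn_of_eventually hNS hu3 bump hbr
      (hQnQ m) hL'
    exact ⟨G, hG⟩
  choose G hG using hG
  obtain ⟨G', hG', -⟩ := exists_hasWeakSpatialGradientOn_of_exhaustion (Q := parCylOpens 0 1)
    hmono hcov hG
  exact ⟨G', hG'⟩

/-! ### (as6): weak gradient and finite energy up to the final time -/

set_option maxHeartbeats 1600000 in
/-- **Seregin–Šverák 2009, (as6) from Remark 3.4, without the axial symmetry.** Under the
standing assumptions of §3 (`v ∈ L³(Q)`, `q ∈ L^{3/2}(Q)`, Navier–Stokes in `𝒟'(Q)`) and (r2)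
(`v` essentially bounded on `Q ∩ {t < -a²}` for all `0 < a < 1`), the velocity has a weak
spatial gradient `∇v = G` on `Q` and `A(0, 3/4; v) + E(0, 3/4; ∇v) < ∞`
(Remark 3.4: "the pair `v` and `q` forms a suitable weak solution … in `Q`", Def. 2.2:
`v ∈ L_{2,∞}(Q) ∩ W^{1,0}_2(Q)`; p. 6: "condition (b8) allows us to extend this property to the
whole cylinder `Q`"). See the module docstring for the proof.
[cite: SereginSverak2009, Remark 3.4 and proof of Lemma 3.5, (as6) (arXiv pp. 6, 9)] -/
theorem exists_hasWeakSpatialGradientOn_energy_lt_top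
    (hNS : IsDistributionalNSSolutionOn (parCylOpens (0 : ℝ × EuclideanSpace ℝ (Fin 3)) 1) 1 0 u p)
    (hu3 : ∫⁻ z in parCyl (0 : ℝ × EuclideanSpace ℝ (Fin 3)) 1, ‖u z.1 z.2‖ₑ ^ (3 : ℕ) < ∞)
    (hp : ∫⁻ z in parCyl (0 : ℝ × EuclideanSpace ℝ (Fin 3)) 1, ‖p z.1 z.2‖ₑ ^ (3 / 2 : ℝ) < ∞)
    (hbd : IsBoundedAwayFromZero u) :
    ∃ G : ℝ → (EuclideanSpace ℝ (Fin 3)) → (EuclideanSpace ℝ (Fin 3)) →L[ℝ] (EuclideanSpace ℝ (Fin 3)), HasWeakSpatialGradientOn (parCylOpens 0 1) u G ∧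
      energyA 0 (3 / 4) u + dissipationE 0 (3 / 4) G < ∞ := by
  haveI : (volume : Measure (ℝ × EuclideanSpace ℝ (Fin 3))).IsAddHaarMeasure := Measure.prod.instIsAddHaarMeasure _ _
  set Q : Opens (ℝ × EuclideanSpace ℝ (Fin 3)) := parCylOpens 0 1 with hQdef
  have hQ : (Q : Set (ℝ × EuclideanSpace ℝ (Fin 3))) = parCyl 0 1 := rfl
  have hQm : MeasurableSet (Q : Set (ℝ × EuclideanSpace ℝ (Fin 3))) := Q.isOpen.measurableSet
  have hQbdd : Bornology.IsBounded (Q : Set (ℝ × EuclideanSpace ℝ (Fin 3))) := by rw [hQ]; exact isBounded_parCyl_zero_one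
  obtain ⟨bump, hbr, -⟩ := FunctionSpaces.exists_contDiffBump_seq (E := ℝ × EuclideanSpace ℝ (Fin 3))
  set V : ℕ → ℝ → (EuclideanSpace ℝ (Fin 3)) → (EuclideanSpace ℝ (Fin 3)) := fun n => stMollify ((bump n).normed volume) (zeroExt Q u) with hV
  -- ## the weak gradient on `Q`
  obtain ⟨G, hG⟩ := exists_hasWeakSpatialGradientOn_parCyl hNS hu3 hp hbd bump hbr
  refine ⟨G, hG, ?_⟩
  -- ## classes of `u`, the zero extension and the `L²` convergence of the mollifications
  haveI : IsFiniteMeasure (volume.restrict (Q : Set (ℝ × EuclideanSpace ℝ (Fin 3)))) :=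
    ⟨by rw [Measure.restrict_apply_univ]; exact hQbdd.measure_lt_top⟩
  have hvm : AEStronglyMeasurable (uncurry u) (volume.restrict (Q : Set (ℝ × EuclideanSpace ℝ (Fin 3)))) :=
    hNS.1.aestronglyMeasurable
  have hu3' : ∫⁻ z in (Q : Set (ℝ × EuclideanSpace ℝ (Fin 3))), ‖u z.1 z.2‖ₑ ^ (3 : ℕ) < ∞ := by rw [hQ]; exact hu3
  have hp' : ∫⁻ z in (Q : Set (ℝ × EuclideanSpace ℝ (Fin 3))), ‖p z.1 z.2‖ₑ ^ (3 / 2 : ℝ) < ∞ := by rw [hQ]; exact hp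
  have hv3Q : MemLp (uncurry u) 3 (volume.restrict (Q : Set (ℝ × EuclideanSpace ℝ (Fin 3)))) := by
    have := memLp_nat_of_lintegral_lt_top hvm (n := 3) (by norm_num) (by exact hu3')
    simpa using this
  have hv2Q : MemLp (uncurry u) 2 (volume.restrict (Q : Set (ℝ × EuclideanSpace ℝ (Fin 3)))) :=
    hv3Q.mono_exponent (by norm_num)
  set ũ : ℝ × EuclideanSpace ℝ (Fin 3) → (EuclideanSpace ℝ (Fin 3)) := zeroExt Q u with hũ
  have hũ2 : MemLp ũ 2 volume := memLp_zeroExt rfl hQm hv2Q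
  have hũi : LocallyIntegrable ũ volume := locallyIntegrable_zeroExt (hv2Q.integrable one_le_two)
  have hVsm : ∀ n, ContDiff ℝ (⊤ : ℕ∞) (uncurry (V n)) := fun n =>
    contDiff_uncurry_stMollify (bump n).contDiff_normed (bump n).hasCompactSupport_normed hũi
  have hVc : ∀ n, Continuous (uncurry (V n)) := fun n => (hVsm n).continuous
  have mV2 : ∀ n, MemLp (uncurry (V n)) 2 volume := fun n =>
    UnboundedOperators.memLp_convolution_lsmul (bump n).integrable_normed hũ2 (by norm_num)
  have cV2 : Tendsto (fun n => eLpNorm (uncurry (V n) - ũ) 2 volume) atTop (𝓝 0) :=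
    FunctionSpaces.tendsto_eLpNorm_normed_convolution_sub_self hbr (by norm_num) (by norm_num) hũ2
  have hVcs : ∀ n, HasCompactSupport (uncurry (V n)) := fun n =>
    (bump n).hasCompactSupport_normed.convolution _ (hasCompactSupport_zeroExt hQbdd u)
  -- ## the cut-off and the uniform bound
  obtain ⟨φ, hφ, hφ0, hφ1, hφa, hφone, hmargin⟩ := exists_cutoff
  obtain ⟨M, hM⟩ := exists_eventually_mollified_energy_le hQbdd one_pos hNS hu3' hp' hφ hφ0 hφa
    bump hbr
  -- the bound at every time `-1 ≤ t < 0`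
  have hyp : ∀ t ∈ Ico (-1 : ℝ) 0, ∀ᶠ n in atTop,
      (∫ y, φ t y * ‖V n t y‖ ^ 2) + 2 * 1 * ∫ z in Ioo (-1 : ℝ) t ×ˢ (univ : Set (EuclideanSpace ℝ (Fin 3))),
        φ z.1 z.2 * frobeniusNormSq (fderiv ℝ (V n z.1) z.2) ≤ M := by
    intro t ht
    obtain ⟨δ, hδ, hδQ⟩ := hmargin t ht.2
    set δ' : ℝ := min δ (-t / 2) with hδ'
    have hδ'0 : 0 < δ' := lt_min hδ (by linarith [ht.2])
    have hδ'1 : δ' ≤ δ := min_le_left _ _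
    have hδ'2 : δ' ≤ -t / 2 := min_le_right _ _
    have hgeo : ∀ z ∈ tsupport (uncurry φ), z.1 ≤ t → closedBall z δ' ⊆ (Q : Set (ℝ × EuclideanSpace ℝ (Fin 3))) :=
      fun z hz hzt => (closedBall_subset_closedBall hδ'1).trans (by rw [hQ]; exact hδQ z hz hzt)
    have hKb : ∃ Kb : ℝ, ∀ᵐ z ∂(volume.restrict (Q : Set (ℝ × EuclideanSpace ℝ (Fin 3)))), z.1 < t + δ' →
        ‖u z.1 z.2‖ ≤ Kb := by
      have hpos : 0 < -(t + δ') := by linarith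
      have hlt1 : -(t + δ') < 1 := by linarith [ht.1]
      have ha : Real.sqrt (-(t + δ')) ∈ Ioo (0 : ℝ) 1 := by
        refine ⟨Real.sqrt_pos.2 hpos, ?_⟩
        rw [show (1 : ℝ) = Real.sqrt 1 from Real.sqrt_one.symm]
        exact Real.sqrt_lt_sqrt hpos.le hlt1
      obtain ⟨Kb, hKb⟩ := hbd _ ha
      refine ⟨Kb, ?_⟩
      rw [hQ]
      filter_upwards [hKb] with z hz hzt
      refine hz ?_
      rw [Real.sq_sqrt hpos.le]
      linarith
    exact hM t (by linarith [ht.1]) δ' hδ'0 hgeo hKb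
  -- ## the dissipation `E(0, 3/4)`
  have hE : dissipationE 0 (3 / 4) G < ∞ := by
    -- the increasing open sets `S m = ]-9/16, -1/(m+2)[ × 𝒞(3/4)`
    set τ : ℕ → ℝ := fun m => -(1 / ((m : ℝ) + 2)) with hτ
    have hτneg : ∀ m, τ m < 0 := fun m => by simp only [hτ]; exact neg_neg_of_pos (by positivity)
    have hτlow : ∀ m, -(9 : ℝ) / 16 < τ m := fun m => by
      simp only [hτ]
      have : 1 / ((m : ℝ) + 2) ≤ 1 / 2 := by gcongr; linarith [(Nat.cast_nonneg m : (0 : ℝ) ≤ m)]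
      linarith
    have hτmono : Monotone τ := fun m m' h => by
      simp only [hτ]
      have : 1 / ((m' : ℝ) + 2) ≤ 1 / ((m : ℝ) + 2) := by gcongr
      linarith
    set S : ℕ → Set (ℝ × EuclideanSpace ℝ (Fin 3)) := fun m =>
      {z | z.1 ∈ Ioo (-(9 : ℝ) / 16) (τ m) ∧ cylRadius z.2 < 3 / 4 ∧ |z.2 2| < 3 / 4} with hS
    have hSo : ∀ m, IsOpen (S m) := fun m => by
      have hc : Continuous fun z : ℝ × EuclideanSpace ℝ (Fin 3) => cylRadius z.2 := continuous_cylRadius.comp continuous_snd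
      have h3 : Continuous fun z : ℝ × EuclideanSpace ℝ (Fin 3) => |z.2 2| := by fun_prop
      exact (isOpen_Ioo.preimage continuous_fst).inter
        ((isOpen_lt hc continuous_const).inter (isOpen_lt h3 continuous_const))
    have hSQ : ∀ m, S m ⊆ parCyl (0 : ℝ × EuclideanSpace ℝ (Fin 3)) 1 := fun m z hz => by
      obtain ⟨⟨h1, h2⟩, hr, h3⟩ := hz
      rw [mem_parCyl_zero]
      exact ⟨⟨by linarith, by linarith [hτneg m]⟩, by linarith, by linarith⟩
    -- the sharp bound of the mollified dissipation on `S m`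
    have hSbd : ∀ m, ∀ᶠ n in atTop, ∫⁻ z in S m, ENNReal.ofReal (frobeniusNormSq
        (fderiv ℝ (V n z.1) z.2)) ≤ ENNReal.ofReal (M / 2) := by
      intro m
      have ht : τ m ∈ Ico (-1 : ℝ) 0 := ⟨by linarith [hτlow m], hτneg m⟩
      obtain ⟨Kx, hKx, hKxt⟩ := hφ.exists_compact_slice_subset
      have hφKx : ∀ s, ∀ y ∉ Kx, φ s y = 0 := fun s y hy =>
        image_eq_zero_of_notMem_tsupport fun h => hy (hKxt s h)
      have cφ : Continuous (uncurry φ) := hφ.contDiff.continuous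
      filter_upwards [hyp (τ m) ht] with n hn
      set F : ℝ × EuclideanSpace ℝ (Fin 3) → ℝ := fun z => φ z.1 z.2 * frobeniusNormSq (fderiv ℝ (V n z.1) z.2) with hF
      have sV : IsSmoothSpaceTimeOn univ (V n) := (hVsm n).contDiffOn
      have cF : Continuous F := cφ.mul (LerayHopfProofs.continuous_frobeniusNormSq.comp
        (sV.fderiv_slice uniqueDiffOn_univ).continuous_uncurry)
      have iF : IntegrableOn F (Ioo (-1 : ℝ) (τ m) ×ˢ (univ : Set (EuclideanSpace ℝ (Fin 3)))) volume :=
        integrableOn_slab_of_continuous hKx cF fun s y hy => by simp only [hF, hφKx s y hy, zero_mul]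
      have hFnn : ∀ z, 0 ≤ F z := fun z => mul_nonneg (hφ0 z.1 z.2) (frobeniusNormSq_nonneg _)
      have hL0 : 0 ≤ ∫ y, φ (τ m) y * ‖V n (τ m) y‖ ^ 2 :=
        integral_nonneg fun y => mul_nonneg (hφ0 _ y) (sq_nonneg _)
      have hGd : ∫ z in Ioo (-1 : ℝ) (τ m) ×ˢ (univ : Set (EuclideanSpace ℝ (Fin 3))), F z ≤ M / 2 := by linarith
      have hSslab : S m ⊆ Ioo (-1 : ℝ) (τ m) ×ˢ (univ : Set (EuclideanSpace ℝ (Fin 3))) := fun z hz =>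
        ⟨⟨by linarith [hz.1.1], hz.1.2⟩, mem_univ _⟩
      have hφS : ∀ z ∈ S m, φ z.1 z.2 = 1 := fun z hz =>
        hφone z.1 ⟨hz.1.1.le, by linarith [hz.1.2, hτneg m]⟩ z.2 hz.2.1.le hz.2.2.le
      calc ∫⁻ z in S m, ENNReal.ofReal (frobeniusNormSq (fderiv ℝ (V n z.1) z.2))
          = ∫⁻ z in S m, ENNReal.ofReal (F z) := by
            refine setLIntegral_congr_fun (hSo m).measurableSet fun z hz => ?_
            simp only [hF, hφS z hz, one_mul]
        _ ≤ ∫⁻ z in Ioo (-1 : ℝ) (τ m) ×ˢ (univ : Set (EuclideanSpace ℝ (Fin 3))), ENNReal.ofReal (F z) :=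
            lintegral_mono_set hSslab
        _ = ENNReal.ofReal (∫ z in Ioo (-1 : ℝ) (τ m) ×ˢ (univ : Set (EuclideanSpace ℝ (Fin 3))), F z) :=
            (ofReal_integral_eq_lintegral_ofReal iF (Eventually.of_forall hFnn)).symm
        _ ≤ ENNReal.ofReal (M / 2) := ENNReal.ofReal_le_ofReal hGd
    -- the glued gradient inherits the bound on every `S m`
    have hGS : ∀ m, ∫⁻ z in S m, ENNReal.ofReal (frobeniusNormSq (G z.1 z.2)) ≤
        ENNReal.ofReal (M / 2) := by
      intro m
      obtain ⟨G', hG', hG'bd⟩ := exists_hasWeakSpatialGradientOn_of_eventually hNS hu3 bump hbr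
        (Ω := ⟨S m, hSo m⟩) (hSQ m) (hSbd m)
      have hle : (⟨S m, hSo m⟩ : Opens (ℝ × EuclideanSpace ℝ (Fin 3))) ≤ Q := fun z hz => hSQ m hz
      have hae := (hG.mono hle).ae_eq hG'
      calc ∫⁻ z in S m, ENNReal.ofReal (frobeniusNormSq (G z.1 z.2))
          = ∫⁻ z in S m, ENNReal.ofReal (frobeniusNormSq (G' z.1 z.2)) := by
            refine lintegral_congr_ae ?_
            filter_upwards [hae] with z hz
            change ENNReal.ofReal (frobeniusNormSq (uncurry G z)) =
              ENNReal.ofReal (frobeniusNormSq (uncurry G' z))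
            rw [hz]
        _ ≤ ENNReal.ofReal (M / 2) := hG'bd
    -- monotone union `⋃ S m = Q(0, 3/4)`
    have hSdir : Directed (· ⊆ ·) S := Monotone.directed_le fun m m' h z hz =>
      ⟨⟨hz.1.1, hz.1.2.trans_le (hτmono h)⟩, hz.2⟩
    have hU : parCyl (0 : ℝ × EuclideanSpace ℝ (Fin 3)) (3 / 4) = ⋃ m, S m := by
      ext z
      rw [mem_parCyl_zero, mem_iUnion]
      constructor
      · rintro ⟨⟨h1, h2⟩, hr, h3⟩
        obtain ⟨m, hm⟩ := exists_nat_one_div_lt (neg_pos.2 h2)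
        refine ⟨m, ⟨⟨by nlinarith, ?_⟩, hr, h3⟩⟩
        simp only [hτ]
        have : 1 / ((m : ℝ) + 2) ≤ 1 / ((m : ℝ) + 1) := by gcongr; norm_num
        linarith
      · rintro ⟨m, ⟨h1, h2⟩, hr, h3⟩
        exact ⟨⟨by nlinarith, h2.trans (hτneg m)⟩, hr, h3⟩
    have hlin : ∫⁻ z in parCyl (0 : ℝ × EuclideanSpace ℝ (Fin 3)) (3 / 4), ENNReal.ofReal (frobeniusNormSq (G z.1 z.2)) ≤
        ENNReal.ofReal (M / 2) := by
      rw [hU, setLIntegral_iUnion_of_directed _ hSdir]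
      exact iSup_le hGS
    rw [dissipationE]
    exact ENNReal.mul_lt_top (ENNReal.inv_lt_top.2 (ENNReal.ofReal_pos.2 (by norm_num)))
      (hlin.trans_lt ENNReal.ofReal_lt_top)
  -- ## the energy `A(0, 3/4)`
  have hA : energyA 0 (3 / 4) u < ∞ := by
    -- a subsequence with sliced `L²` convergence for a.e. time
    obtain ⟨ns, hns, hsl⟩ := exists_subseq_tendsto_eLpNorm_slice (ν := (volume : Measure (EuclideanSpace ℝ (Fin 3))))
      (D := fun n z => V n z.1 z.2 - ũ z)
      (fun n => by
        rw [← Measure.volume_eq_prod]; exact ((mV2 n).sub hũ2).1)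
      (fun n => by
        rw [← Measure.volume_eq_prod]; exact ((mV2 n).sub hũ2).eLpNorm_lt_top)
      (by rw [← Measure.volume_eq_prod]; exact cV2)
    have hfinslice : ∀ᵐ s : ℝ, ∫⁻ y, ‖ũ (s, y)‖ₑ ^ 2 < ∞ := by
      have hm : AEMeasurable (fun z : ℝ × EuclideanSpace ℝ (Fin 3) => ‖ũ z‖ₑ ^ 2)
          ((volume : Measure ℝ).prod (volume : Measure (EuclideanSpace ℝ (Fin 3)))) := by
        rw [← Measure.volume_eq_prod]; exact hũ2.1.enorm.pow_const 2
      refine ae_lt_top' hm.lintegral_prod_right' ?_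
      rw [← lintegral_prod _ hm, ← Measure.volume_eq_prod, ← MollifiedLimits.eLpNorm_two_pow_two]
      exact ENNReal.pow_ne_top hũ2.eLpNorm_lt_top.ne
    have hmslice : ∀ᵐ s : ℝ, AEStronglyMeasurable (fun y => ũ (s, y)) volume := by
      set ũ' : ℝ × EuclideanSpace ℝ (Fin 3) → (EuclideanSpace ℝ (Fin 3)) := hũ2.1.mk ũ with hũ'
      have hsm : StronglyMeasurable ũ' := hũ2.1.stronglyMeasurable_mk
      have e : ũ =ᵐ[volume] ũ' := hũ2.1.ae_eq_mk
      rw [Measure.volume_eq_prod] at e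
      have h1 : ∀ᵐ s : ℝ, ∀ᵐ y : (EuclideanSpace ℝ (Fin 3)), ũ (s, y) = ũ' (s, y) := Measure.ae_ae_eq_curry_of_prod e
      filter_upwards [h1] with s hs
      exact ⟨fun y => ũ' (s, y), hsm.comp_measurable measurable_prodMk_left, hs⟩
    have cφ : Continuous (uncurry φ) := hφ.contDiff.continuous
    -- the sliced bound for a.e. `t ∈ ]-9/16, 0[`
    have hslice : ∀ᵐ t ∂(volume.restrict (Ioo (-(9 : ℝ) / 16) 0)),
        ∫⁻ x in spaceCyl (0 : (EuclideanSpace ℝ (Fin 3))) (3 / 4), ‖u t x‖ₑ ^ 2 ≤ ENNReal.ofReal M := by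
      filter_upwards [ae_restrict_mem measurableSet_Ioo, ae_restrict_of_ae hsl,
        ae_restrict_of_ae hfinslice, ae_restrict_of_ae hmslice] with t ht hts htf htm
      have ht' : t ∈ Ico (-1 : ℝ) 0 := ⟨by linarith [ht.1], ht.2⟩
      -- the slice bound for the mollifications, along the subsequence
      have hev : ∀ᶠ j in atTop, ∫ y, φ t y * ‖V (ns j) t y‖ ^ 2 ≤ M := by
        have h1 : ∀ᶠ n in atTop, ∫ y, φ t y * ‖V n t y‖ ^ 2 ≤ M := by
          filter_upwards [hyp t ht'] with n hn
          have hGd : 0 ≤ ∫ z in Ioo (-1 : ℝ) t ×ˢ (univ : Set (EuclideanSpace ℝ (Fin 3))),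
              φ z.1 z.2 * frobeniusNormSq (fderiv ℝ (V n z.1) z.2) :=
            setIntegral_nonneg (measurableSet_Ioo.prod MeasurableSet.univ) fun z _ =>
              mul_nonneg (hφ0 z.1 z.2) (frobeniusNormSq_nonneg _)
          linarith
        exact hns.tendsto_atTop.eventually h1
      -- the limit of the slices
      have mVt : ∀ j, MemLp (fun y => V (ns j) t y) 2 volume := fun j =>
        ((hVc (ns j)).comp (Continuous.prodMk_right t)).memLp_of_hasCompactSupport
          (hasCompactSupport_slice_of_uncurry (hVcs (ns j)) t)
      have mũt : MemLp (fun y => ũ (t, y)) 2 volume := by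
        refine ⟨htm, ?_⟩
        rw [eLpNorm_two_eq_rpow]
        exact ENNReal.rpow_lt_top_of_nonneg (by norm_num) htf.ne
      have hlim : Tendsto (fun j => ∫ y in (univ : Set (EuclideanSpace ℝ (Fin 3))), φ t y * (innerSL ℝ (V (ns j) t y)) (V (ns j) t y))
          atTop (𝓝 (∫ y in (univ : Set (EuclideanSpace ℝ (Fin 3))), φ t y * (innerSL ℝ (ũ (t, y))) (ũ (t, y)))) :=
        tendsto_setIntegral_mul_bilin (p := 2) (q := 2) one_le_two (innerSL ℝ) mVt mũt mVt mũt hts hts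
          (cφ.comp (Continuous.prodMk_right t)).aestronglyMeasurable
          (Eventually.of_forall fun y => show ‖φ t y‖ ≤ 1 by
            rw [Real.norm_eq_abs, abs_of_nonneg (hφ0 t y)]; exact hφ1 t y) univ
      simp only [Measure.restrict_univ, innerSL_apply_apply, real_inner_self_eq_norm_sq] at hlim
      have hbound : ∫ y, φ t y * ‖ũ (t, y)‖ ^ 2 ≤ M := le_of_tendsto hlim hev
      -- identification on the cylinder `𝒞(3/4)`
      have iw : Integrable (fun y => φ t y * ‖ũ (t, y)‖ ^ 2) (volume : Measure (EuclideanSpace ℝ (Fin 3))) :=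
        (mũt.integrable_norm_pow two_ne_zero).bdd_mul
          (cφ.comp (Continuous.prodMk_right t)).aestronglyMeasurable
          (Eventually.of_forall fun y => show ‖φ t y‖ ≤ 1 by
            rw [Real.norm_eq_abs, abs_of_nonneg (hφ0 t y)]; exact hφ1 t y)
      calc ∫⁻ x in spaceCyl (0 : (EuclideanSpace ℝ (Fin 3))) (3 / 4), ‖u t x‖ₑ ^ 2
          = ∫⁻ x in spaceCyl (0 : (EuclideanSpace ℝ (Fin 3))) (3 / 4), ENNReal.ofReal (φ t x * ‖ũ (t, x)‖ ^ 2) := by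
            refine setLIntegral_congr_fun (isOpen_spaceCyl 0 _).measurableSet fun x hx => ?_
            rw [mem_spaceCyl] at hx
            simp only [sub_zero, PiLp.zero_apply] at hx
            have hxQ : ((t, x) : ℝ × EuclideanSpace ℝ (Fin 3)) ∈ (Q : Set (ℝ × EuclideanSpace ℝ (Fin 3))) := by
              rw [hQ, mem_parCyl_zero]
              exact ⟨⟨by linarith [ht.1], ht.2⟩, by linarith [hx.1], by linarith [hx.2]⟩
            have hũx : ũ (t, x) = u t x := zeroExt_of_mem _ hxQ
            have hφx : φ t x = 1 := hφone t ⟨ht.1.le, by linarith [ht.2]⟩ x hx.1.le hx.2.le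
            rw [hφx, one_mul, hũx, ← ofReal_norm, ENNReal.ofReal_pow (norm_nonneg _)]
        _ ≤ ∫⁻ x, ENNReal.ofReal (φ t x * ‖ũ (t, x)‖ ^ 2) := setLIntegral_le_lintegral _ _
        _ = ENNReal.ofReal (∫ y, φ t y * ‖ũ (t, y)‖ ^ 2) :=
            (ofReal_integral_eq_lintegral_ofReal iw (Eventually.of_forall fun y =>
              mul_nonneg (hφ0 t y) (sq_nonneg _))).symm
        _ ≤ ENNReal.ofReal M := ENNReal.ofReal_le_ofReal hbound
    -- the essential supremum
    have e1 : Ioo ((0 : ℝ × EuclideanSpace ℝ (Fin 3)).1 - (3 / 4) ^ 2) (0 : ℝ × EuclideanSpace ℝ (Fin 3)).1 = Ioo (-(9 : ℝ) / 16) 0 := by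
      norm_num
    rw [energyA, e1]
    have e2 : (0 : ℝ × EuclideanSpace ℝ (Fin 3)).2 = 0 := rfl
    simp only [e2]
    refine lt_of_le_of_lt (essSup_le_of_ae_le ((ENNReal.ofReal (3 / 4))⁻¹ * ENNReal.ofReal M) ?_) ?_
    · filter_upwards [hslice] with t ht
      gcongr
    · exact ENNReal.mul_lt_top (ENNReal.inv_lt_top.2 (ENNReal.ofReal_pos.2 (by norm_num)))
        ENNReal.ofReal_lt_top
  exact ENNReal.add_lt_top.2 ⟨hA, hE⟩

/-! ### The discharge -/

/-- **Discharge of `SereginSverak2009.GradientEnergyBound`** (Seregin–Šverák 2009, proof of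
Lemma 3.5, (as6) with Remark 3.4): under the assumptions of Thm. 3.1 the velocity has a weak
spatial gradient on `Q` and `A(0, 3/4; v) + E(0, 3/4; ∇v) < ∞` — the standing assumptions are
fields of `IsAxisymmetricLocalSolution`, (r2) follows from the Type I bound
(`isBoundedAwayFromZero_of_isTypeIOnCyl`), and `exists_hasWeakSpatialGradientOn_energy_lt_top`
applies (axial symmetry is not needed).
[cite: SereginSverak2009, proof of Lemma 3.5, (as6), with Remark 3.4] -/
theorem GradientEnergyBound_holds : GradientEnergyBound := by
  intro u p hsol hI
  exact exists_hasWeakSpatialGradientOn_energy_lt_top hsol.distributional hsol.velocity_L3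
    hsol.pressure_L32 (isBoundedAwayFromZero_of_isTypeIOnCyl hI)

end Analytic

end SereginSverak2009

end Literature.Analysis.FluidPDE
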